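import Summits.Ventures.HSemireg.DualNumberFlatCriterion
import Literature.RingTheory.FittingIdeal.Annihilator
import Literature.RingTheory.FittingIdeal.Functoriality
import Mathlib.Algebra.Module.Torsion.Basic
import Mathlib.RingTheory.Flat.Basic
import HarnessLib

/-!
# Venture HSemireg — the Fitting ideal of a cyclic module, and the Fitting lift of a flat cyclic deformation

For a commutative ring `A` and a CYCLIC `A`-module `E` (`E = A·e`):
* `fittingIdeal_zero_quotient_eq` — `Fitt₀(A ⧸ I) = I` for every ideal `I` (Stacks 07ZA (1));
* `fittingIdeal_zero_eq_torsionOf` — `Fitt₀(E) = Ann(e)` (`= Ann(E)`), via `E ≃ A ⧸ Ann(e)`;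
* `flat_quotient_fittingIdeal_of_cyclic` — **if `A` is a `K[ε]`-algebra and the cyclic `E` is flat
  over `K[ε]`, then `A ⧸ Fitt₀(E)` is flat over `K[ε]`**: the closed subscheme `V(Fitt₀(E))` cut out
  by the (canonical, base-change compatible) Fitting ideal of a flat cyclic first-order deformation
  is itself a flat first-order deformation — the «cyclic case» of LEMMA F and the engine of THEOREM
  CC-F / CC-D (a) of the cell record `widen/W1/CLEAN-COMPONENT-THEOREM-w1tw1.md` §16–§18.

HONEST FRAMING. Elementary commutative algebra on top of the tree's Fitting-ideal library
(`Literature/RingTheory/FittingIdeal`) and `DualNumberFlatCriterion`; Lean index of one step of a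
NEGATIVE structure theorem of the computation cell `pub-hsemireg` (seat w1-tw-1, W1). No scheme,
abelian variety or semiregularity map appears; nothing here says that HC, HC_CM or HC_AV holds,
and nothing here is a new case of anything.
-/

open DualNumber

namespace Summit.Ventures.HSemireg

namespace CyclicFitting

universe u v w

open Literature.RingTheory.FittingIdeal

variable {A : Type u} [CommRing A]

/-- **`Fitt₀(A ⧸ I) = I`** (Stacks 07ZA (1)): `⊇` is the Literature lemma
`Module.mem_fittingIdeal_zero_quotient`, `⊆` is `Fitt₀ ⊆ Ann` and `Ann(A ⧸ I) = I`.
[cite: Eisenbud1995, §20.2] -/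
theorem fittingIdeal_zero_quotient_eq (I : Ideal A) :
    Module.fittingIdeal A (A ⧸ I) 0 = I := by
  refine le_antisymm ?_ (fun i hi => Module.mem_fittingIdeal_zero_quotient I hi)
  intro a ha
  have h := Module.fittingIdeal_zero_le_annihilator (R := A) (M := A ⧸ I) ha
  rw [Module.mem_annihilator] at h
  have h1 : (Ideal.Quotient.mk I a) = 0 := by
    have := h (1 : A ⧸ I)
    rwa [Algebra.smul_def, mul_one, Ideal.Quotient.algebraMap_eq] at this
  exact Ideal.Quotient.eq_zero_iff_mem.mp h1

variable {E : Type v} [AddCommGroup E] [Module A E]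

/-- For a cyclic module `E = A·e`: **`Fitt₀(E) = Ann(e)`** (the torsion ideal of the generator,
which is the annihilator of `E`). [cite: Eisenbud1995, §20.2] -/
theorem fittingIdeal_zero_eq_torsionOf (e : E) (he : Submodule.span A {e} = ⊤) :
    Module.fittingIdeal A E 0 = Ideal.torsionOf A E e := by
  -- `A ⧸ Ann(e) ≃ A·e = E`
  let φ : (A ⧸ Ideal.torsionOf A E e) ≃ₗ[A] E :=
    (Ideal.quotTorsionOfEquivSpanSingleton A E e).trans (LinearEquiv.ofTop _ he)
  rw [← Module.fittingIdeal_eq_of_linearEquiv φ 0, fittingIdeal_zero_quotient_eq]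

variable {K : Type w} [Field K] [Algebra K[ε] A] [Module K[ε] E] [IsScalarTower K[ε] A E]

/-- **The Fitting lift of a flat cyclic first-order deformation is flat.** If `A` is a
`K[ε]`-algebra and the CYCLIC `A`-module `E` is flat over `K[ε]`, then `A ⧸ Fitt₀(E)` is flat over
`K[ε]` (it is `K[ε]`-isomorphic to `E`). With `A = O(U_ξ)` and `E` a flat cyclic deformation of a
sheaf this says: `V(Fitt₀(E))` is a `k[ε]`-flat closed subscheme — the cyclic case of LEMMA F of
the cell record. [cite: Eisenbud1995, §20.2] -/
theorem flat_quotient_fittingIdeal_of_cyclic [Module.Flat K[ε] E] (e : E)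
    (he : Submodule.span A {e} = ⊤) :
    Module.Flat K[ε] (A ⧸ Module.fittingIdeal A E 0) :=
  -- the canonical `A ⧸ Fitt₀(E) ≃ₗ[A] E` (`1̄ ↦ e`), restricted to `K[ε]`
  Module.Flat.of_linearEquiv
    (((Submodule.quotEquivOfEq _ _ (fittingIdeal_zero_eq_torsionOf e he)).trans
      ((Ideal.quotTorsionOfEquivSpanSingleton A E e).trans (LinearEquiv.ofTop _ he))).restrictScalars K[ε])

/-- The same in the criterion form of `DualNumberFlatCriterion`: every `a ∈ A` with
`ε • a ∈ Fitt₀(E)` lies in `Fitt₀(E) + εA` («`(Fitt₀ : ε) = Fitt₀ + (ε)`» — relations lift).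
[cite: Matsumura1987, §22 Thm. 22.3] -/
theorem eps_smul_mem_fittingIdeal_imp [Module.Flat K[ε] E] (e : E)
    (he : Submodule.span A {e} = ⊤) (a : A)
    (ha : (ε : K[ε]) • a ∈ Module.fittingIdeal A E 0) :
    ∃ a' : A, a - (ε : K[ε]) • a' ∈ Module.fittingIdeal A E 0 := by
  haveI := flat_quotient_fittingIdeal_of_cyclic (K := K) e he
  exact (DualNumberFlat.quotient_flat_iff (K := K)
    ((Module.fittingIdeal A E 0).restrictScalars K[ε])).mp
    (inferInstance : Module.Flat K[ε] (A ⧸ Module.fittingIdeal A E 0)) a ha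

end CyclicFitting

end Summit.Ventures.HSemireg
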